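import Summits.ResolutionOfSingularities.ResolutionOfSingularities.Theorems.FrobeniusLadderFRationalModificationMaxMultiplicityCertificateCone
import Summits.ResolutionOfSingularities.ResolutionOfSingularities.Theorems.FrobeniusLadderFRationalModificationMaxMultiplicityCertificateInitialForm
import Summits.ResolutionOfSingularities.ResolutionOfSingularities.Theorems.FrobeniusLadderFRationalModificationMaxMultiplicityCertificateTangentChart
import Summits.ResolutionOfSingularities.ResolutionOfSingularities.Theorems.FrobeniusLadderFRationalModificationMaxMultiplicityCertificateChartClause
import Literature.RingTheory.RegularLocalRing.SopRegular
import Literature.RingTheory.HilbertSamuel.TangentConeIdeal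
import Literature.AlgebraicGeometry.Resolution.AffineBlowup
import Literature.RingTheory.TightClosure.TightClosure
import Mathlib.RingTheory.RegularLocalRing.Defs
import HarnessLib

/-!
# The pointwise certificate on the blow-up of a maximal-multiplicity F-pure hypersurface point

Crux stmt-ResolutionOfSingularities-15316 (`FrobeniusLadder.FRationalModification`), line
`socle-discrepancy-certificate`, registered stub `stub_maxMultiplicityCertificate` (socle card, theorem-schema
(1), the provable-now local producer).

Let `(S, 𝔪, κ)` be a regular local ring of characteristic `p` and dimension `n+1`, `f ∈ 𝔪^{n+1}` with
`f^{p-1} ∉ 𝔪^[p]` (Fedder: `S/(f)` is F-pure; this forces `ord f = n+1`), and `R ≅ S/(f)` a local domain with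
`𝔪_R ≠ 0` whose punctured spectrum is regular. Then EVERY point `w` of the blow-up `Bl_{𝔪_R}(Spec R)`
(`affineBlowup`, `AffineBlowup.lean`) is regular or certified: `𝒪_w` is a domain and the local equation `t`
of the exceptional divisor `E` is a non-zero element of `𝔪_w` with `𝒪_w[1/t]` regular and `𝒪_w/(t)`
Cohen–Macaulay with Frobenius-closed parameter ideals.

Assembly (`stub_maxMultiplicityCertificate`):
* a regular system of parameters `x` of `S` is a regular, hence quasi-regular, sequence
  (`SopRegular`, `QuasiRegularSequences`); `f = F(x)` for a form `F` of degree `n+1`, and Fedder's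
  hypothesis makes the coefficient of `(T₀⋯T_n)^{p-1}` in `F^{p-1}` a unit (`coeff_diag_notMem`), so the
  initial form `F̄ ∈ κ[T₀, …, T_n]` satisfies `F̄^{p-1} ∉ (T_j^p)` (`map_notMem_span_X_pow`) and `F ∉ 𝔪 S[T]`;
* stalks of the blow-up are local rings `A_q` of the charts `A = (R[𝔪t])_{(x̄_i t)}`
  (`StalkChartIso.stub_stalkChartIso`), and the certificate is invariant under ring isomorphisms
  (`good_of_ringEquiv`);
* on a chart, `…ChartClause.chartCertificate` reduces everything to the clause at the local rings of the
  exceptional chart `A/(x̄_i/1)`, which is the chart `κ[T_j : j ≠ i]/(F̄(T_i := 1))` of the tangent cone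
  `Proj κ[T]/(F̄)` (`…TangentChart.tangentConeChart_ringEquiv`, fed by
  `…InitialForm.hypersurface_initialForm_rel`), where Fedder's test holds at every prime
  (`…Cone.coneChart_notMem_frobeniusPower`) and gives the clause
  (`…ChartClause.exceptional_clause_of_presentation`).

References: R. Fedder, Trans. AMS 278 (1983), Prop. 1.7, Thm. 1.12; The Stacks Project, Tags 0804, 02OS;
H. Matsumura, *Commutative Ring Theory*, §16–17. [folklore]
-/

-- single-problem summit: the doubled namespace component `ResolutionOfSingularities` is forced
set_option linter.dupNamespace false

noncomputable section

namespace Summit.ResolutionOfSingularities.ResolutionOfSingularities.Theorems.FRationalModification.MaxMultiplicityCertificate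

open CategoryTheory AlgebraicGeometry TopologicalSpace MvPolynomial IsLocalRing
open Literature.AlgebraicGeometry.Resolution Literature.RingTheory.TightClosure
open Summit.ResolutionOfSingularities.ResolutionOfSingularities.Theorems
open Summit.ResolutionOfSingularities.ResolutionOfSingularities.Theorems.FRationalModification

/-- The Cohen–Macaulay + Frobenius-closed clause of the crux at a ring `X` (inline form). -/
local notation3 "CLAUSE[" p ", " X "]" => ∀ d : ℕ, ringKrullDim X = (d : WithBot ℕ∞) → ∀ s : Fin d → X,
  (Ideal.radical (R := X) (Ideal.span (Set.range s))).IsMaximal →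
    RingTheory.Sequence.IsWeaklyRegular X (List.ofFn s) ∧
    ∀ y : X, (∃ e : ℕ, y ^ p ^ e ∈ Ideal.span ((fun z : X => z ^ p ^ e) '' (Ideal.span (Set.range s) : Set X))) →
      y ∈ Ideal.span (Set.range s)

/-- The pointwise certificate at a local ring `L`: regular, or a domain with a non-zero `t ∈ 𝔪_L`, `L[1/t]`
regular and `L/(t)` Cohen–Macaulay with Frobenius-closed parameter ideals (inline form). -/
local notation3 "GOOD[" p ", " L "]" => IsRegularLocalRing L ∨ (IsDomain L ∧ ∃ t : L,
  t ∈ IsLocalRing.maximalIdeal L ∧ t ≠ 0 ∧ IsRegularRing (Localization.Away t) ∧ CLAUSE[p, L ⧸ Ideal.span {t}])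

/-! ## §1 Fedder's hypothesis read on the initial form -/

section FedderCoeff

variable {S : Type*} [CommRing S] {r : ℕ} (x : Fin r → S)

/-- **The diagonal coefficient is a unit.** If a form `G` of degree `r·q` in `x₀, …, x_{r-1}` has
`G(x) ∉ (x)^[q+1]`, then its coefficient at `(T₀⋯T_{r-1})^q` does not lie in `(x)`: every other monomial of
degree `r·q` has an exponent `≥ q+1`, and `c·(x₀⋯x_{r-1})^q ∈ (x)^[q+1]` for `c ∈ (x)`. (With `G = F^{p-1}`,
`q = p-1`: Fedder's `f^{p-1} ∉ 𝔪^[p]` forces a unit coefficient of `(T₀⋯T_n)^{p-1}` in `F^{p-1}`.)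
[folklore; cf. Fedder1983 Prop. 1.7] -/
theorem coeff_diag_notMem (q : ℕ) {G : MvPolynomial (Fin r) S} (hG : G.IsHomogeneous (r * q))
    (h : eval x G ∉ frobeniusPower (q + 1) (Ideal.span (Set.range x))) :
    coeff (Finsupp.equivFunOnFinite.symm fun _ : Fin r => q) G ∉ Ideal.span (Set.range x) := by
  classical
  set α₀ : Fin r →₀ ℕ := Finsupp.equivFunOnFinite.symm fun _ : Fin r => q with hα₀
  have hα₀j : ∀ j, α₀ j = q := fun j => by rw [hα₀, Finsupp.coe_equivFunOnFinite_symm]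
  set J : Ideal S := frobeniusPower (q + 1) (Ideal.span (Set.range x)) with hJ
  have hxJ : ∀ j, x j ^ (q + 1) ∈ J := fun j => pow_mem_frobeniusPower (Ideal.subset_span ⟨j, rfl⟩)
  intro hc
  apply h
  rw [eval_eq']
  refine Ideal.sum_mem _ fun d hd => ?_
  by_cases hdα : d = α₀
  · -- the diagonal monomial: its coefficient lies in `(x)`
    rw [hdα]
    obtain ⟨c, hc'⟩ := Ideal.mem_span_range_iff_exists_fun.mp hc
    rw [← hc', Finset.sum_mul]
    refine Ideal.sum_mem _ fun j _ => ?_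
    rw [← Finset.mul_prod_erase Finset.univ (fun l => x l ^ α₀ l) (Finset.mem_univ j), hα₀j j,
      mul_assoc, ← mul_assoc (x j), ← pow_succ']
    exact Ideal.mul_mem_left _ _ (Ideal.mul_mem_right _ _ (hxJ j))
  · -- another monomial of degree `r q`: some exponent is `≥ q + 1`
    have hdeg : ∑ j, d j = r * q := by
      have h1 : d.degree = r * q := by
        by_contra hne
        exact (mem_support_iff.mp hd) (hG.coeff_eq_zero hne)
      rwa [Finsupp.degree_eq_sum] at h1
    have hex : ∃ j, q + 1 ≤ d j := by
      by_contra hall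
      push Not at hall
      apply hdα
      ext j
      have hle : ∀ j ∈ (Finset.univ : Finset (Fin r)), d j ≤ α₀ j :=
        fun j _ => (hα₀j j).symm ▸ Nat.lt_succ_iff.mp (hall j)
      have hsum : ∑ j, d j = ∑ j, α₀ j := by
        rw [hdeg, Finset.sum_congr rfl fun j _ => hα₀j j, Finset.sum_const, Finset.card_univ,
          Fintype.card_fin, smul_eq_mul]
      exact (Finset.sum_eq_sum_iff_of_le hle).mp hsum j (Finset.mem_univ j)
    obtain ⟨j, hj⟩ := hex
    rw [← Finset.mul_prod_erase Finset.univ (fun l => x l ^ d l) (Finset.mem_univ j),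
      ← Nat.add_sub_of_le hj, pow_add]
    exact Ideal.mul_mem_left _ _ (Ideal.mul_mem_right _ _ (Ideal.mul_mem_right _ _ (hxJ j)))

/-- **Fedder's hypothesis on the initial form**: with `G` as in `coeff_diag_notMem` and `τ : S → k` a ring
map killing at most `(x)` (`τ s = 0 ⇒ s ∈ (x)`; e.g. `S → κ`), the reduction `τG ∈ k[T₀, …, T_{r-1}]` does
not lie in the monomial ideal `(T₀^{q+1}, …, T_{r-1}^{q+1})` — its diagonal coefficient is non-zero.
[folklore; cf. Fedder1983 Prop. 1.7] -/
theorem map_notMem_span_X_pow {k : Type*} [CommRing k] (τ : S →+* k)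
    (hτ : ∀ s, τ s = 0 → s ∈ Ideal.span (Set.range x)) (q : ℕ) {G : MvPolynomial (Fin r) S}
    (hG : G.IsHomogeneous (r * q)) (h : eval x G ∉ frobeniusPower (q + 1) (Ideal.span (Set.range x))) :
    MvPolynomial.map τ G ∉ Ideal.span (Set.range fun j : Fin r => (X j : MvPolynomial (Fin r) k) ^ (q + 1)) := by
  classical
  have hc := coeff_diag_notMem x q hG h
  have hrange : (Set.range fun j : Fin r => (X j : MvPolynomial (Fin r) k) ^ (q + 1)) =
      (fun s => monomial s (1 : k)) '' Set.range (fun j : Fin r => Finsupp.single j (q + 1)) := by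
    rw [← Set.range_comp]
    refine congrArg Set.range (funext fun j => ?_)
    simp only [Function.comp_apply, X_pow_eq_monomial]
  rw [hrange, mem_ideal_span_monomial_image]
  intro hmem
  have hsupp : (Finsupp.equivFunOnFinite.symm fun _ : Fin r => q) ∈ (MvPolynomial.map τ G).support := by
    rw [mem_support_iff, coeff_map]
    exact fun h0 => hc (hτ _ h0)
  obtain ⟨si, ⟨j, rfl⟩, hle⟩ := hmem _ hsupp
  have h1 := Finsupp.single_le_iff.mp hle
  rw [Finsupp.coe_equivFunOnFinite_symm] at h1
  omega

end FedderCoeff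

/-! ## §2 Dehomogenization commutes with change of coefficients -/

/-- Killing `T_i` commutes with a change of coefficients `τ`: `τ(H(T_i := 1)) = (τH)(T_i := 1)`.
[folklore] -/
theorem map_aeval_kill {A A' : Type*} [CommRing A] [CommRing A'] (τ : A →+* A') {r : ℕ} (i : Fin r)
    (H : MvPolynomial (Fin r) A) :
    MvPolynomial.map τ (aeval (fun j : Fin r => if h : j = i then (1 : MvPolynomial {j : Fin r // j ≠ i} A)
      else X ⟨j, h⟩) H) =
    aeval (fun j : Fin r => if h : j = i then (1 : MvPolynomial {j : Fin r // j ≠ i} A') else X ⟨j, h⟩)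
      (MvPolynomial.map τ H) := by
  have hcomp : (MvPolynomial.map τ).comp (aeval (fun j : Fin r => if h : j = i then
      (1 : MvPolynomial {j : Fin r // j ≠ i} A) else X ⟨j, h⟩)).toRingHom =
      (aeval (fun j : Fin r => if h : j = i then (1 : MvPolynomial {j : Fin r // j ≠ i} A') else X ⟨j, h⟩)).toRingHom.comp
        (MvPolynomial.map τ) := by
    refine ringHom_ext (fun c => ?_) (fun j => ?_)
    · change MvPolynomial.map τ (aeval _ (C c)) = aeval _ (MvPolynomial.map τ (C c))
      rw [algHom_C, algebraMap_eq, map_C, map_C, algHom_C, algebraMap_eq]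
    · change MvPolynomial.map τ (aeval _ (X j)) = aeval _ (MvPolynomial.map τ (X j))
      rw [aeval_X, map_X, aeval_X]
      split_ifs
      · rw [map_one]
      · rw [map_X]
  exact RingHom.congr_fun hcomp H

/-! ## §3 The certificate is invariant under ring isomorphisms -/

/-- The pointwise certificate transports along a ring isomorphism of local rings. [folklore] -/
theorem good_of_ringEquiv (p : ℕ) {L L' : Type} [CommRing L] [CommRing L'] [IsLocalRing L] [IsLocalRing L']
    (e : L ≃+* L') (h : GOOD[p, L]) : GOOD[p, L'] := by
  rcases h with hreg | ⟨hdom, t, htm, ht0, hregt, hcl⟩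
  · haveI := hreg
    exact Or.inl (IsRegularLocalRing.of_ringEquiv e)
  · right
    haveI := hdom
    refine ⟨MulEquiv.isDomain L e.symm.toMulEquiv, e t, ?_, ?_, ?_, ?_⟩
    · rw [IsLocalRing.mem_maximalIdeal] at htm ⊢
      exact fun hu => htm (by simpa using hu.map e.symm)
    · exact (RingEquiv.map_ne_zero_iff e).mpr ht0
    · haveI := hregt
      exact IsRegularRing.of_ringEquiv (IsLocalization.ringEquivOfRingEquiv (M := Submonoid.powers t)
        (T := Submonoid.powers (e t)) (Localization.Away t) (Localization.Away (e t)) e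
        (Submonoid.map_powers e.toMonoidHom t))
    · have hmap : Ideal.span {e t} = Ideal.map (e : L →+* L') (Ideal.span {t}) := by
        rw [Ideal.map_span, Set.image_singleton]
        rfl
      exact FInjectiveMacaulayfication.DegreeZeroDescent.inlineClause_of_ringEquiv p
        (Ideal.quotientEquiv _ _ e hmap) hcl

/-! ## §4 The stub -/

/-- **`stub_maxMultiplicityCertificate`** (registered stub of crux stmt-ResolutionOfSingularities-15316, line
`socle-discrepancy-certificate`; socle card, theorem-schema (1)). An isolated singularity `R ≅ S/(f)`, `S`
regular local of characteristic `p` and dimension `n+1`, `f ∈ 𝔪^{n+1}`, `f^{p-1} ∉ 𝔪^[p]`: every point of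
the blow-up of the closed point of `Spec R` is regular or certified (domain; `t ∈ 𝔪 ∖ 0` with `𝒪[1/t]`
regular and `𝒪/(t)` Cohen–Macaulay with Frobenius-closed parameter ideals) — the exceptional divisor is the
reduced F-pure tangent cone `Proj κ[T₀, …, T_n]/(in f)`. [folklore; Fedder1983 Thm. 1.12] -/
theorem stub_maxMultiplicityCertificate
    (p : ℕ) [Fact p.Prime] (S : Type) [CommRing S] [IsRegularLocalRing S] [CharP S p] (n : ℕ) (f : S) (hdim
    : ringKrullDim S = ((n + 1 : ℕ) : WithBot ℕ∞)) (hmult : f ∈ IsLocalRing.maximalIdeal S ^ (n + 1)) (hF :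
    f ^ (p - 1) ∉ frobeniusPower p (IsLocalRing.maximalIdeal S)) (R : Type) [CommRing R] [IsNoetherianRing
    R] [IsLocalRing R] [IsDomain R] [CharP R p] (e : R ≃+* S ⧸ Ideal.span {f}) (hm :
    IsLocalRing.maximalIdeal R ≠ ⊥) (hreg : ∀ (q : Ideal R) [q.IsPrime], q ≠ IsLocalRing.maximalIdeal R →
    IsRegularLocalRing (Localization.AtPrime q)) : ∀ w : affineBlowup (IsLocalRing.maximalIdeal R),
    IsRegularLocalRing ((affineBlowup (IsLocalRing.maximalIdeal R)).presheaf.stalk w) ∨ (IsDomain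
    ((affineBlowup (IsLocalRing.maximalIdeal R)).presheaf.stalk w) ∧ ∃ t : (affineBlowup
    (IsLocalRing.maximalIdeal R)).presheaf.stalk w, t ∈ IsLocalRing.maximalIdeal ((affineBlowup
    (IsLocalRing.maximalIdeal R)).presheaf.stalk w) ∧ t ≠ 0 ∧ IsRegularRing (Localization.Away t) ∧ ∀ d : ℕ,
    ringKrullDim (((affineBlowup (IsLocalRing.maximalIdeal R)).presheaf.stalk w) ⧸ Ideal.span {t}) = d → ∀ s
    : Fin d → ((affineBlowup (IsLocalRing.maximalIdeal R)).presheaf.stalk w) ⧸ Ideal.span {t}, (Ideal.span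
    (Set.range s)).radical.IsMaximal → RingTheory.Sequence.IsWeaklyRegular (((affineBlowup
    (IsLocalRing.maximalIdeal R)).presheaf.stalk w) ⧸ Ideal.span {t}) (List.ofFn s) ∧ ∀ y : ((affineBlowup
    (IsLocalRing.maximalIdeal R)).presheaf.stalk w) ⧸ Ideal.span {t}, (∃ e : ℕ, y ^ p ^ e ∈ Ideal.span ((fun
    z : ((affineBlowup (IsLocalRing.maximalIdeal R)).presheaf.stalk w) ⧸ Ideal.span {t} => z ^ p ^ e) ''
    (Ideal.span (Set.range s) : Set (((affineBlowup (IsLocalRing.maximalIdeal R)).presheaf.stalk w) ⧸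
    Ideal.span {t})))) → y ∈ Ideal.span (Set.range s)) := by
  classical
  -- (`hm : 𝔪_R ≠ 0` is part of the registered signature but not needed: for `𝔪_R = 0` the blow-up is
  -- empty and the claim is vacuous)
  have _hm : IsLocalRing.maximalIdeal R ≠ ⊥ := hm
  have hp : p.Prime := Fact.out
  have hp1 : p - 1 + 1 = p := Nat.sub_add_cancel hp.one_lt.le
  haveI : IsDomain S := isDomain_of_isRegularLocalRing S
  -- §a the quotient map `π : S → R`
  set π : S →+* R := e.symm.toRingHom.comp (Ideal.Quotient.mk (Ideal.span {f})) with hπdef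
  have hπs : Function.Surjective π := e.symm.surjective.comp Ideal.Quotient.mk_surjective
  have hπker : ∀ s, π s = 0 ↔ s ∈ Ideal.span {f} := fun s => by
    rw [hπdef, RingHom.comp_apply, RingEquiv.toRingHom_eq_coe, RingHom.coe_coe,
      map_eq_zero_iff _ e.symm.injective, Ideal.Quotient.eq_zero_iff_mem]
  -- §b a regular system of parameters `x` of `S`: regular, hence quasi-regular
  have hrank : (maximalIdeal S).spanFinrank = n + 1 := by
    have h1 := IsRegularLocalRing.spanFinrank_maximalIdeal (R := S)
    rw [hdim] at h1
    exact_mod_cast h1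
  obtain ⟨x, hx⟩ := Literature.RingTheory.HilbertSamuel.exists_span_range_eq_maximalIdeal S hrank.le
  have hxm : ∀ j, x j ∈ maximalIdeal S := fun j => hx ▸ Ideal.subset_span ⟨j, rfl⟩
  have hxreg : RingTheory.Sequence.IsRegular S (List.ofFn x) := by
    refine Literature.RingTheory.RegularLocalRing.isRegular_of_maximalIdeal_pow_le_ofList
      (fun q hq => ?_) ?_ (N := 1) ?_
    · obtain ⟨j, rfl⟩ := List.mem_ofFn.mp hq
      exact hxm j
    · rw [List.length_ofFn, hdim]
    · rw [pow_one, ← hx, Ideal.span_le]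
      rintro _ ⟨j, rfl⟩
      exact Ideal.subset_span (List.mem_ofFn.mpr ⟨j, rfl⟩)
  have hqr : IsQuasiRegular x := isQuasiRegular_of_isWeaklyRegular x hxreg.toIsWeaklyRegular
  -- §c `f = F(x)` for a form `F` of degree `n + 1`; Fedder's hypothesis on the initial form
  have hfm : f ∈ Ideal.span (Set.range x) ^ (n + 1) := by rw [hx]; exact hmult
  obtain ⟨F, hFhom, hFf⟩ := exists_isHomogeneous_of_mem_span_pow x (n + 1) hfm
  have hFpow : (F ^ (p - 1)).IsHomogeneous ((n + 1) * (p - 1)) := hFhom.pow (p - 1)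
  have hFpow_eval : eval x (F ^ (p - 1)) ∉ frobeniusPower (p - 1 + 1) (Ideal.span (Set.range x)) := by
    rw [map_pow, hFf, hp1, hx]
    exact hF
  have hcoeff := coeff_diag_notMem x (p - 1) hFpow hFpow_eval
  have hFm : F ∉ Ideal.map C (Ideal.span (Set.range x)) := fun h =>
    hcoeff (mem_map_C_iff.mp (Ideal.pow_mem_of_mem _ h (p - 1) (Nat.sub_pos_of_lt hp.one_lt)) _)
  -- §d the images `x̄` generate `𝔪_R`
  set xR : Fin (n + 1) → R := fun j => π (x j) with hxRdef
  have hxR : Ideal.span (Set.range xR) = maximalIdeal R := by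
    have h1 : Ideal.span (Set.range xR) = (Ideal.span (Set.range x)).map π := by
      rw [Ideal.map_span, ← Set.range_comp]
      rfl
    rw [h1, hx]
    exact map_maximalIdeal_of_surjective π hπs
  have hF0 : eval xR (MvPolynomial.map π F) = 0 := by
    have h1 : xR = π ∘ x := rfl
    rw [h1, ← map_eval, hFf]
    exact (hπker f).mpr (Ideal.mem_span_singleton_self f)
  have hπker' : ∀ s, π s = 0 ↔ s ∈ Ideal.span {eval x F} := by rw [hFf]; exact hπker
  -- §e the residue field and the initial form `F̄`
  haveI hImax : (Ideal.span (Set.range xR)).IsMaximal := by rw [hxR]; exact maximalIdeal.isMaximal R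
  letI : Field (R ⧸ Ideal.span (Set.range xR)) := Ideal.Quotient.field _
  haveI : CharP (R ⧸ Ideal.span (Set.range xR)) p :=
    CharP.of_ringHom_of_ne_zero (Ideal.Quotient.mk (Ideal.span (Set.range xR))) p hp.ne_zero
  set τ : S →+* R ⧸ Ideal.span (Set.range xR) := (Ideal.Quotient.mk (Ideal.span (Set.range xR))).comp π
    with hτdef
  have hτ : ∀ s, τ s = 0 → s ∈ Ideal.span (Set.range x) := by
    intro s hs
    rw [hτdef, RingHom.comp_apply, Ideal.Quotient.eq_zero_iff_mem, hxR, ← map_maximalIdeal_of_surjective π hπs,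
      Ideal.mem_map_iff_of_surjective π hπs] at hs
    obtain ⟨s', hs', hss'⟩ := hs
    have h1 : s - s' ∈ Ideal.span {f} := (hπker _).mp (by rw [map_sub, hss', sub_self])
    have h2 : Ideal.span {f} ≤ maximalIdeal S := by
      rw [Ideal.span_singleton_le_iff_mem]
      exact Ideal.pow_le_self (Nat.succ_ne_zero n) hmult
    rw [hx]
    have := add_mem (h2 h1) hs'
    rwa [sub_add_cancel] at this
  have hFkn : (MvPolynomial.map τ F) ^ (p - 1) ∉
      Ideal.span (Set.range fun j : Fin (n + 1) => (X j : MvPolynomial (Fin (n + 1)) (R ⧸ Ideal.span (Set.range xR))) ^ p) := by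
    have := map_notMem_span_X_pow x τ hτ (p - 1) hFpow hFpow_eval
    rwa [map_pow, hp1] at this
  -- §f the stalks of the blow-up are local rings of the charts
  rw [← hxR]
  intro w
  obtain ⟨i, q, hxi, ⟨est⟩⟩ := FInjectiveMacaulayfication.StalkChartIso.stub_stalkChartIso R (n + 1) xR w
  -- §g the clause on the exceptional chart `A/(x̄_i/1) ≅ κ[T_j : j ≠ i]/(F̄(T_i := 1))`
  have hexc : ∀ (Q : Ideal (HomogeneousLocalization.Away (reesGrading (Ideal.span (Set.range xR)))
      (reesT (xR i) (Ideal.subset_span (Set.mem_range_self i))) ⧸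
      Ideal.span {reesChartBase (xR i) (Ideal.subset_span (Set.mem_range_self i)) (xR i)})) [Q.IsPrime],
      CLAUSE[p, Localization.AtPrime Q] := by
    intro Q _
    -- the presentation of the exceptional chart
    have hrel : ∀ (N : ℕ) (H : MvPolynomial (Fin (n + 1)) R), H.IsHomogeneous N →
        eval xR H ∈ Ideal.span (Set.range xR) ^ (N + 1) →
          ∃ G : MvPolynomial (Fin (n + 1)) R, H - MvPolynomial.map π F * G ∈
            Ideal.map C (Ideal.span (Set.range xR)) :=
      fun N H hH hHx => MaxMultiplicityCertificateInitialForm.hypersurface_initialForm_rel S (n + 1) x hx hqr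
        (n + 1) F hFhom hFm R π hπs hπker' xR (fun j => rfl) N H hH hHx
    obtain ⟨ε₀⟩ := MaxMultiplicityCertificateTangentChart.tangentConeChart_ringEquiv R (n + 1) xR i (n + 1)
      (MvPolynomial.map π F) (hFhom.map π) hF0 hrel
    have hgg : MvPolynomial.map (Ideal.Quotient.mk (Ideal.span (Set.range xR)))
        (aeval (fun j : Fin (n + 1) => if h : j = i then (1 : MvPolynomial {j : Fin (n + 1) // j ≠ i} R)
          else X ⟨j, h⟩) (MvPolynomial.map π F)) =
        aeval (fun j : Fin (n + 1) => if h : j = i then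
          (1 : MvPolynomial {j : Fin (n + 1) // j ≠ i} (R ⧸ Ideal.span (Set.range xR))) else X ⟨j, h⟩)
          (MvPolynomial.map τ F) := by
      rw [map_aeval_kill, map_map]
    let ε := (Ideal.quotEquivOfEq (congrArg (fun g => Ideal.span {g}) hgg.symm)).trans ε₀
    -- Fedder's test at every prime of the chart, from the vertex of the cone
    have hg : ∀ (Q' : Ideal (MvPolynomial {j : Fin (n + 1) // j ≠ i} (R ⧸ Ideal.span (Set.range xR))))
        [Q'.IsPrime], aeval (fun j : Fin (n + 1) => if h : j = i then
          (1 : MvPolynomial {j : Fin (n + 1) // j ≠ i} (R ⧸ Ideal.span (Set.range xR))) else X ⟨j, h⟩)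
          (MvPolynomial.map τ F) ∈ Q' →
        algebraMap (MvPolynomial {j : Fin (n + 1) // j ≠ i} (R ⧸ Ideal.span (Set.range xR)))
          (Localization.AtPrime Q') (aeval (fun j : Fin (n + 1) => if h : j = i then
            (1 : MvPolynomial {j : Fin (n + 1) // j ≠ i} (R ⧸ Ideal.span (Set.range xR))) else X ⟨j, h⟩)
            (MvPolynomial.map τ F)) ^ (p - 1) ∉
          frobeniusPower p (maximalIdeal (Localization.AtPrime Q')) := by
      intro Q' _ _
      rw [← map_pow, ← map_pow]
      exact MaxMultiplicityCertificateCone.coneChart_notMem_frobeniusPower p (R ⧸ Ideal.span (Set.range xR))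
        (n + 1) i ((n + 1) * (p - 1)) ((MvPolynomial.map τ F) ^ (p - 1)) ((hFhom.map τ).pow (p - 1)) hFkn Q'
    exact MaxMultiplicityCertificateChartClause.exceptional_clause_of_presentation p i _ hg ε Q
  -- §h the certificate on the chart, transported to the stalk
  have hgood := MaxMultiplicityCertificateChartClause.chartCertificate p R (n + 1) xR hxR hreg i hxi hexc q.asIdeal
  exact good_of_ringEquiv p est.symm hgood

end Summit.ResolutionOfSingularities.ResolutionOfSingularities.Theorems.FRationalModification.MaxMultiplicityCertificate

end
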